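import Summits.Parity.GeneralizedHardyLittlewood.Theorems.GreenTaoLevelTwoGITwoCyclicInverseBogolyubov
import Mathlib.Topology.Instances.AddCircle.Real
import Mathlib.Analysis.Normed.Group.AddCircle

/-!
# Route `GreenTaoLevelTwo`, crux `GITwo` (stmt-Parity-21275), line `birth`, stub `stub_cyclicInverse`:
# Bogolyubov's lemma in Bohr-set form (`B(Spec, ¼) ⊆ 2A − 2A`)

Sixteenth helper file toward the XL stub `stub_cyclicInverse` (B. Green, T. Tao, arXiv:math/0503014,
Thm. 68 = PEMS 51 (2008) Thm. 12.8).  The landed counting form of Bogolyubov's lemma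
(`bogolyubov_count`, file `…Bogolyubov`) is hypothesised on `Re e(xξ/M) ≥ 0`; the Bohr-set files of
this line (`…BohrSize`, `…TorusBoxes`, `…GraphSlice`, `…Separation`) speak `‖ZMod.toAddCircle(·)‖`.
This short def-free file bridges the two vocabularies and restates Bogolyubov exactly as arXiv
Lemma 30 uses it in Prop. 43 ("apply Bogolyubov to `H''`: `B(S', ¼) ⊆ 2H'' − 2H''`"):

* `norm_toAddCircle_eq_min` — `‖toAddCircle y‖ = min(val y, M − val y)/M`;
* `re_stdAddChar_nonneg_of_norm_le` — `‖toAddCircle y‖ ≤ ¼ ⇒ Re e(y/M) ≥ 0`;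
* `bohr_largeSpec_subset_two_sub_two` — **Bogolyubov, Bohr form**: for nonempty `A ⊆ ℤ/Mℤ`
  (`β = #A/M`), every `x` with `‖toAddCircle(xξ)‖ ≤ ¼` for all `ξ ≠ 0` with `|1̂_A(ξ)|² ≥ β³/4`
  is of the form `(a − c) + (b − d)`, `a,b,c,d ∈ A` (and that spectrum has `≤ 4β⁻²` elements by
  `card_largeSpec_mul_le`).

References: [GreenTao2008U3Inverse] arXiv:math/0503014, Lemma 30; use in Prop. 43.
-/

noncomputable section

namespace Summit.Parity.GeneralizedHardyLittlewood.GreenTaoLevelTwoGITwoCyclicInverse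

open Finset ZMod

open Literature.NumberTheory.Sieve

variable {M : ℕ} [NeZero M]

/-- `‖toAddCircle y‖ = min(val y, M − val y) / M` on `ℤ/Mℤ`. [folklore] -/
theorem norm_toAddCircle_eq_min (y : ZMod M) :
    ‖ZMod.toAddCircle y‖ = ((min y.val (M - y.val) : ℕ) : ℝ) / M := by
  rw [ZMod.toAddCircle_apply, UnitAddCircle.norm_eq, abs_sub_round_div_natCast_eq,
    Nat.mod_eq_of_lt (ZMod.val_lt y)]

/-- The Bohr condition at radius `¼` in circle-norm form implies the spectral sign condition of
`bogolyubov_count`: `‖toAddCircle y‖ ≤ ¼ ⇒ Re e(y/M) ≥ 0`. [folklore] -/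
theorem re_stdAddChar_nonneg_of_norm_le (y : ZMod M) (hy : ‖ZMod.toAddCircle y‖ ≤ 1 / 4) :
    0 ≤ (stdAddChar y : ℂ).re := by
  have hM : (0 : ℝ) < M := by exact_mod_cast Nat.pos_of_ne_zero (NeZero.ne M)
  refine re_stdAddChar_nonneg_of_val y ?_
  rw [norm_toAddCircle_eq_min, div_le_div_iff₀ hM (by norm_num), one_mul] at hy
  -- `hy : 4 · min(v, M − v) ≤ M` as reals
  have hy' : ((min y.val (M - y.val) : ℕ) : ℝ) * 4 ≤ M := hy
  have hnat : min y.val (M - y.val) * 4 ≤ M := by exact_mod_cast hy'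
  have hv := ZMod.val_lt y
  rcases le_total y.val (M - y.val) with h | h
  · rw [min_eq_left h] at hnat
    left; omega
  · rw [min_eq_right h] at hnat
    right; omega

/-- **Bogolyubov's lemma, Bohr-set form** (`B(Spec_{β³/4}(A) ∖ {0}, ¼) ⊆ 2A − 2A`): for nonempty
`A ⊆ ℤ/Mℤ` with `β = #A/M`, every `x` with `‖toAddCircle(x ξ)‖ ≤ ¼` for all nonzero `ξ` of the large
spectrum `{|1̂_A(ξ)|² ≥ β³/4}` is `(a − c) + (b − d)` with `a, b, c, d ∈ A`.
[cite: GreenTao2008U3Inverse, Lemma 30] -/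
theorem bohr_largeSpec_subset_two_sub_two {A : Finset (ZMod M)} (hA : A.Nonempty) (x : ZMod M)
    (hx : ∀ ξ : ZMod M, ξ ≠ 0 →
      ((#A : ℝ) / M) ^ 3 / 4 ≤ ‖dftCoeff (fun y => if y ∈ A then (1 : ℝ) else 0) ξ‖ ^ 2 →
        ‖ZMod.toAddCircle (x * ξ)‖ ≤ 1 / 4) :
    ∃ a ∈ A, ∃ c ∈ A, ∃ b ∈ A, ∃ d ∈ A, a - c + (b - d) = x :=
  exists_sub_add_sub_eq_of_re_nonneg hA x fun ξ hξ hspec =>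
    re_stdAddChar_nonneg_of_norm_le (x * ξ) (hx ξ hξ hspec)

end Summit.Parity.GeneralizedHardyLittlewood.GreenTaoLevelTwoGITwoCyclicInverse
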